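import Mathlib.LinearAlgebra.AffineSpace.FiniteDimensional
import Mathlib.Data.Finset.Card
import Mathlib.Tactic
import HarnessLib

/-!
# Coplanar subsets: «every `n`-subset lies in a plane, one triple spans ⇒ the whole set is in that plane»

Kernel leaf for the W1 twisted squad (cell `pub-hsemireg`, seat w1-tw-2 gen 12), the incidence step that
closes THEOREM S (§26.7 (S1)), (S6), (W7)(a) and (S3) ADDENDUM (iii) of `CLEAN-COMPONENT-THEOREM-w1tw1.md`
(READ ×2 in `PSTU-READ-tw2.md`): the norm condition makes every six of the eight points `ev(r₁), …, ev(r₈)`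
of the sextic `Γ_ev ⊂ ℙ³` coplanar; since some three of them span a plane, all eight lie in that plane —
contradicting `deg Γ_ev = 6`.  The purely affine-geometric content is formalised here over an arbitrary
division ring:

* `eq_affineSpan_of_finrank_direction_le_two` — an affine subspace whose direction has `finrank ≤ 2` and
  which contains an affinely independent triple IS the affine span of that triple;
* `subset_affineSpan_of_subsets_coplanar` — if a finite set `s` contains an affinely independent triple `u`
  and every `n`-subset of `s` (for some `4 ≤ n ≤ #s`) lies in an affine subspace of direction-`finrank ≤ 2`,
  then `s` lies in the plane `affineSpan k (range u)`.

(The projective statement used in the note follows by passing to an affine chart containing the finitely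
many points.)  Honest framing: elementary linear algebra, theorems only; nothing here bears on HC / HC_CM /
HC_AV.
-/

namespace Summit.Ventures.HSemireg.CoplanarSubsets

open AffineSubspace Module

variable {k : Type*} [DivisionRing k] {V : Type*} [AddCommGroup V] [Module k V]
  {P : Type*} [AddTorsor V P]

/-- An affine subspace of direction-`finrank ≤ 2` containing an affinely independent triple `u` equals
the affine span of `u` (the plane of the triple). -/
theorem eq_affineSpan_of_finrank_direction_le_two {u : Fin 3 → P} (hu : AffineIndependent k u)
    {Q : AffineSubspace k P} [FiniteDimensional k Q.direction]
    (hQ : finrank k Q.direction ≤ 2) (huQ : ∀ i, u i ∈ Q) :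
    affineSpan k (Set.range u) = Q := by
  have hle : affineSpan k (Set.range u) ≤ Q :=
    affineSpan_le_of_subset_coe (by rintro _ ⟨i, rfl⟩; exact huQ i)
  have hdir : (affineSpan k (Set.range u)).direction = Q.direction := by
    apply Submodule.eq_of_le_of_finrank_le (direction_le hle)
    rw [direction_affineSpan, hu.finrank_vectorSpan (Fintype.card_fin 3)]
    exact hQ
  exact eq_of_direction_eq_of_nonempty_of_le hdir
    ⟨u 0, mem_affineSpan k (Set.mem_range_self 0)⟩ hle

/-- A point of an affine subspace of direction-`finrank ≤ 2` that contains an affinely independent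
triple `u` lies in the plane of `u`. -/
theorem mem_affineSpan_of_finrank_direction_le_two {u : Fin 3 → P} (hu : AffineIndependent k u)
    {Q : AffineSubspace k P} [FiniteDimensional k Q.direction]
    (hQ : finrank k Q.direction ≤ 2) (huQ : ∀ i, u i ∈ Q) {p : P} (hp : p ∈ Q) :
    p ∈ affineSpan k (Set.range u) := by
  rw [eq_affineSpan_of_finrank_direction_le_two hu hQ huQ]
  exact hp

/-- **Coplanarity from coplanar `n`-subsets.**  Let `s` be a finite set of points containing an affinely
independent triple `u`, and let `4 ≤ n ≤ #s`.  If every `n`-element subset of `s` is contained in some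
affine subspace whose direction has `finrank ≤ 2`, then all of `s` lies in the plane spanned by `u`.
(Used with `(n, #s) = (6, 8)`, `(6, 7)` and `(5, 8)` in the CC note.) -/
theorem subset_affineSpan_of_subsets_coplanar [FiniteDimensional k V] [DecidableEq P]
    (s : Finset P) {u : Fin 3 → P} (hu : AffineIndependent k u) (hus : ∀ i, u i ∈ s)
    {n : ℕ} (hn : 4 ≤ n) (hns : n ≤ s.card)
    (H : ∀ t : Finset P, t ⊆ s → t.card = n →
      ∃ Q : AffineSubspace k P, finrank k Q.direction ≤ 2 ∧ (↑t : Set P) ⊆ Q) :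
    (↑s : Set P) ⊆ affineSpan k (Set.range u) := by
  intro p hp
  rw [Finset.mem_coe] at hp
  -- the set `u ∪ {p}` has at most four points and sits inside `s`
  set t₀ : Finset P := insert p (Finset.univ.image u) with ht₀
  have ht₀s : t₀ ⊆ s := by
    intro x hx
    rw [ht₀, Finset.mem_insert, Finset.mem_image] at hx
    rcases hx with rfl | ⟨i, -, rfl⟩
    · exact hp
    · exact hus i
  have ht₀card : t₀.card ≤ n := by
    calc t₀.card ≤ (Finset.univ.image u).card + 1 := Finset.card_insert_le _ _
      _ ≤ (Finset.univ : Finset (Fin 3)).card + 1 := by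
          gcongr; exact Finset.card_image_le
      _ = 4 := by simp
      _ ≤ n := hn
  -- enlarge it to an `n`-subset `t` of `s` and take the plane `Q` of `t`
  obtain ⟨t, ht₀t, hts, htcard⟩ := Finset.exists_subsuperset_card_eq ht₀s ht₀card hns
  obtain ⟨Q, hQ, htQ⟩ := H t hts htcard
  have huQ : ∀ i, u i ∈ Q := fun i =>
    htQ (Finset.mem_coe.mpr (ht₀t (by
      rw [ht₀]; exact Finset.mem_insert_of_mem (Finset.mem_image_of_mem u (Finset.mem_univ i)))))
  have hpQ : p ∈ Q := htQ (Finset.mem_coe.mpr (ht₀t (by rw [ht₀]; exact Finset.mem_insert_self p _)))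
  exact mem_affineSpan_of_finrank_direction_le_two hu hQ huQ hpQ

end Summit.Ventures.HSemireg.CoplanarSubsets
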